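import Literature.Probability.Percolation.SlabRSWSnapDatum
import Literature.Probability.Percolation.SlabRSWGluingBound
import Literature.Probability.Percolation.SlabRSWGluingContact
import HarnessLib

/-!
# Newman–Tassion–Wu 2017, Lemma 3.16 on the coarse-grained domain — the two wall cases: direct
# gluings near `A = C` (left wall) and near `C = τC` (right wall)

Topic: `Literature/Probability/Percolation`. For the coarse-grained gluing datum `Q₂ = snapGlue k n hn Γ`
(`SlabRSWSnapDatum.lean`: `R = R' = [0,14n]×[0,13n-1]`, `A = {0}×[5n,13n-1]`, `C = {14n}×[5n,13n-1]`,
whatever `S` and `B`) and a lattice configuration of `𝒳` (`Γ₁ = Γ_min` exists, `C` not yet glued to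
`A` inside `R̄'`), two of the cases of the local modification are DIRECT GLUINGS (NTW's steps (2)–(3)
in the degenerate geometry where the modification touches `Ā` or `C̄`; the tree's `DirectGlue`,
`SlabRSWGluingDirect/Contact.lean`) and do not depend on the obstacle `N(Γ)` at all:

* `gadget_snap_nearA` — the normalised contact path from `c₀ ∈ C̄` ends at `q` and a cell of `A` lies
  within `13` of `planar q`: the `C`-cluster is glued to `Ā` inside the box `(planar q + B₁₃) ∩ R'`
  (port = first entry of the contact path into the box);
* `gadget_snap_nearC` — a cell of `C` lies within `13` of the cell of a vertex `g₀` of `Γ₁`: the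
  `A`-cluster (which contains `Γ₁`) is glued to `C̄` inside `(planar g₀ + B₁₃) ∩ R'` (port = first entry
  of `Γ₁`); this also covers the trivial contact `q = c₀`.

Both give `GadgetSpec Q₂ k 14 ω ω'` (cleared set inside a box of radius `13 ≤ 14`), for `n ≥ 2`
(so that the box does not reach the opposite wall).

## Sources

* C. M. Newman, V. Tassion, W. Wu, *Critical percolation and the minimal spanning tree in slabs*,
  Comm. Pure Appl. Math. 70 (2017), arXiv:1512.09107: §3.2, proof of Theorem 3.7, steps (1)–(3) near
  `Ā`/`C̄`; §3.5, proof of Lemma 3.16 [NewmanTassionWu2017].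
-/

noncomputable section

namespace Literature.Probability.Percolation

open MeasureTheory LatticeModels SimpleGraph

namespace NTW17

variable {k : ℕ} {n : ℕ} (hn : 1 ≤ n) {Γ : List (slab 3 k)} {ω : BondConfig (slab 3 k)}

/-- The clipped box `(z + B₁₃) ∩ R'` as a `boxR`. [cite: NewmanTassionWu2017, §3.2 (proof of Theorem 3.7, the ball B_{r+2}(z) ∩ R)] -/
theorem mem_clipBox_iff {z w : ℤ × ℤ} :
    w ∈ boxR (max 0 (z.1 - 13)) (min (14 * (n : ℤ)) (z.1 + 13)) (max 0 (z.2 - 13)) (min (13 * (n : ℤ) - 1) (z.2 + 13)) ↔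
      w ∈ boxR 0 (14 * n) 0 (13 * n - 1) ∧ w ∈ sqBox z 13 := by
  rw [mem_boxR_iff, mem_boxR_iff, mem_sqBox_iff']
  push_cast
  omega

/-- **Direct gluing near the left wall.** `Q₂ = snapGlue k n hn Γ`, `n ≥ 2`, `ω` a lattice configuration of
`𝒳(Q₂)`; a normalised contact: `c₀ ∈ C̄`, an `ω`-open self-avoiding path `l ++ [q]` inside `R̄'` from
`c₀`; and a cell of `A` within `13` of `planar q`. Then a local modification of radius `14` exists (the
`C`-cluster glued directly to `Ā`). [cite: NewmanTassionWu2017, §3.2 (proof of Theorem 3.7, steps (2)–(3) near A); §3.5 (proof of Lemma 3.16)] -/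
theorem gadget_snap_nearA (hn2 : 2 ≤ n) (hω : ω ⊆ (slabGraph 3 k).edgeSet)
    (hX : ω ∈ (snapGlue k n hn Γ).evX k) {c₀ q : slab 3 k} {l : List (slab 3 k)}
    (hc₀ : c₀ ∈ slabLift k (snapGlue k n hn Γ).C)
    (hch : (l ++ [q]).IsChain (fun a b => s(a, b) ∈ ω ∧ a ≠ b)) (hnd : (l ++ [q]).Nodup)
    (hsub : ∀ x ∈ l ++ [q], x ∈ slabLift k (snapGlue k n hn Γ).R) (hhead : (l ++ [q]).head (by simp) = c₀)
    (hA' : ∃ a' ∈ (snapGlue k n hn Γ).A, a' ∈ sqBox (planar k q) 13) :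
    ∃ ω', GadgetSpec (snapGlue k n hn Γ) k 14 ω ω' := by
  set Q := snapGlue k n hn Γ with hQ
  set z : ℤ × ℤ := planar k q with hz
  set D : Set (ℤ × ℤ) := boxR (max 0 (z.1 - 13)) (min (14 * (n : ℤ)) (z.1 + 13)) (max 0 (z.2 - 13))
    (min (13 * (n : ℤ) - 1) (z.2 + 13)) with hD
  have memD : ∀ w, w ∈ D ↔ w ∈ boxR 0 (14 * n) 0 (13 * n - 1) ∧ w ∈ sqBox z 13 := fun w => mem_clipBox_iff
  obtain ⟨a', ha'A, ha'z⟩ := hA'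
  have ha'c : a'.1 = 0 ∧ 5 * (n : ℤ) ≤ a'.2 ∧ a'.2 ≤ 13 * n - 1 := by
    rw [hQ, snapGlue_A, sideSeg, Set.mem_setOf_eq] at ha'A; exact ha'A
  have hzx : z.1 ≤ 13 := by
    rw [mem_sqBox_iff'] at ha'z; push_cast at ha'z; omega
  have hDR : D ⊆ Q.R := fun w hw => by rw [hQ, snapGlue_R]; exact ((memD w).1 hw).1
  -- `D` is off `C` (the right wall is far) and the target `a'` is in `D`
  have hDC : ∀ w ∈ D, w ∉ Q.C := by
    intro w hw hwC
    rw [hQ, mem_snapGlue_C_iff] at hwC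
    have h1 := ((memD w).1 hw).2
    rw [mem_sqBox_iff'] at h1; push_cast at h1; omega
  have ha'D : a' ∈ D := by
    rw [memD, mem_boxR_iff]; exact ⟨by omega, ha'z⟩
  have hc₀c : (planar k c₀).1 = 14 * n := by
    have : planar k c₀ ∈ Q.C := hc₀
    rw [hQ, mem_snapGlue_C_iff] at this; exact this.1
  have hc₀D : planar k c₀ ∉ D := fun h => hDC _ h hc₀
  -- the port: first entry of the contact path into `D̄`
  have hne : l ++ [q] ≠ [] := by simp
  have hheadD : planar k ((l ++ [q]).head hne) ∉ D := by rw [hhead]; exact hc₀D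
  have hqD : planar k q ∈ D := by
    rw [memD]
    refine ⟨?_, mem_sqBox_self _ _⟩
    have := hsub q (by simp)
    rw [mem_slabLift_iff, hQ, snapGlue_R] at this; exact this
  obtain ⟨m, w', rest, hm, hLeq, hmD, hw'D, hedge, -, hmhead, hconn, -⟩ :=
    exists_entry (R := Q.R) hch hnd hsub hne hheadD ⟨q, by simp, hqD⟩
  rw [hhead] at hconn
  have hadj : (slabGraph 3 k).Adj (m.getLast hm) w' := (SimpleGraph.mem_edgeSet _).1 (hω hedge)
  have hw'L : w' ∈ l ++ [q] := by rw [hLeq]; simp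
  -- `w'` is joined to `c₀ ∈ C̄` inside `R̄`: it cannot lie over `A` (else `C ⟷^R A`)
  have hw'A : planar k w' ∉ Q.A := by
    intro hA'
    have hL : IsOSAP k ω (slabLift k Q.R) {c₀} {q} (l ++ [q]) :=
      ⟨hnd, hch, hsub, hne, fun h => by rw [Set.mem_singleton_iff, ← hhead], fun h => by simp⟩
    have hj := hL.openConnIn_of_mem hw'L
    rw [hhead] at hj
    exact hX.2 ⟨c₀, hc₀, w', hA', hj⟩
  obtain ⟨dg, hdg⟩ := exists_directGlue (R := Q.R) (Src := Q.C) (Tg := Q.A) (xL := max 0 (z.1 - 13))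
    (xR := min (14 * (n : ℤ)) (z.1 + 13)) (rB := max 0 (z.2 - 13)) (rT := min (13 * (n : ℤ) - 1) (z.2 + 13))
    hDR hDC hc₀ (hmD _ (List.getLast_mem hm)) hconn hadj hw'D hw'A ha'D ha'A
  refine ⟨dg.newConfig, GadgetSpec.of_directGlue_A hX dg ⟨z, fun w hw => ?_⟩⟩
  rw [hdg] at hw
  exact sqBox_mono _ (by norm_num) ((memD w).1 hw).2

/-- **Direct gluing near the right wall.** `Q₂ = snapGlue k n hn Γ`, `n ≥ 2`, `ω` a lattice configuration
of `𝒳(Q₂)`, and a cell of `C` within `13` of the cell of a vertex `g₀` of `Γ₁ = Γ_min`. Then a local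
modification of radius `14` exists (the `A`-cluster, which contains `Γ₁`, glued directly to `C̄`; the
port is the first entry of `Γ₁` into the box). This covers in particular the trivial contact `q = c₀`
(a vertex of `C̄` within `1` of `Γ̄₁`). [cite: NewmanTassionWu2017, §3.2 (proof of Theorem 3.7, steps (2)–(3) near C); §3.5 (proof of Lemma 3.16)] -/
theorem gadget_snap_nearC (hn2 : 2 ≤ n) (hω : ω ⊆ (slabGraph 3 k).edgeSet)
    (hX : ω ∈ (snapGlue k n hn Γ).evX k) {g₀ : slab 3 k} (hg₀ : g₀ ∈ (snapGlue k n hn Γ).γ k ω)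
    (hC' : ∃ c' ∈ (snapGlue k n hn Γ).C, c' ∈ sqBox (planar k g₀) 13) :
    ∃ ω', GadgetSpec (snapGlue k n hn Γ) k 14 ω ω' := by
  set Q := snapGlue k n hn Γ with hQ
  have hA : ω ∈ Q.evAB k := hX.1
  obtain ⟨hΓ₁O, -⟩ := Q.γ_spec hA
  set Γ₁ := Q.γ k ω with hΓ₁
  set z : ℤ × ℤ := planar k g₀ with hz
  set D : Set (ℤ × ℤ) := boxR (max 0 (z.1 - 13)) (min (14 * (n : ℤ)) (z.1 + 13)) (max 0 (z.2 - 13))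
    (min (13 * (n : ℤ) - 1) (z.2 + 13)) with hD
  have memD : ∀ w, w ∈ D ↔ w ∈ boxR 0 (14 * n) 0 (13 * n - 1) ∧ w ∈ sqBox z 13 := fun w => mem_clipBox_iff
  obtain ⟨c', hc'C, hc'z⟩ := hC'
  have hc'c : c'.1 = 14 * n ∧ 5 * (n : ℤ) ≤ c'.2 ∧ c'.2 ≤ 13 * n - 1 := by
    rw [hQ, mem_snapGlue_C_iff] at hc'C; exact hc'C
  have hzx : 14 * (n : ℤ) - 13 ≤ z.1 := by
    rw [mem_sqBox_iff'] at hc'z; push_cast at hc'z; omega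
  have hDR : D ⊆ Q.R := fun w hw => by rw [hQ, snapGlue_R]; exact ((memD w).1 hw).1
  -- `D` is off `A` (the left wall is far) and the target `c'` is in `D`
  have hDA : ∀ w ∈ D, w ∉ Q.A := by
    intro w hw hwA
    rw [hQ, snapGlue_A, sideSeg, Set.mem_setOf_eq] at hwA
    have h1 := ((memD w).1 hw).2
    rw [mem_sqBox_iff'] at h1; push_cast at h1; omega
  have hc'D : c' ∈ D := by
    rw [memD, mem_boxR_iff]; exact ⟨by omega, hc'z⟩
  -- `Γ₁`: from `Ā` (off `D`) into `D` (at `g₀`)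
  have hsub : ∀ x ∈ Γ₁, x ∈ slabLift k Q.R := fun x hx => Q.γ_subset_R hA hx
  have hhdA : planar k (Γ₁.head hΓ₁O.ne_nil) ∈ Q.A := hΓ₁O.head_mem hΓ₁O.ne_nil
  have hheadD : planar k (Γ₁.head hΓ₁O.ne_nil) ∉ D := fun h => hDA _ h hhdA
  have hg₀D : z ∈ D := by
    rw [memD]
    refine ⟨?_, mem_sqBox_self _ _⟩
    have := hsub g₀ hg₀
    rw [mem_slabLift_iff, hQ, snapGlue_R] at this; exact this
  obtain ⟨m, w', rest, hm, hLeq, hmD, hw'D, hedge, -, hmhead, hconn, -⟩ :=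
    exists_entry (R := Q.R) hΓ₁O.chain hΓ₁O.nodup hsub hΓ₁O.ne_nil hheadD ⟨g₀, hg₀, hg₀D⟩
  have hadj : (slabGraph 3 k).Adj (m.getLast hm) w' := (SimpleGraph.mem_edgeSet _).1 (hω hedge)
  have hw'Γ : w' ∈ Γ₁ := by rw [hLeq]; simp
  -- `w'` is a vertex of `Γ₁`: it is not over `C` (else `C ⟷^R A` along `Γ₁`)
  have hw'C : planar k w' ∉ Q.C := fun h => not_mem_C_of_mem_γ hX hw'Γ h
  have hnAC : ω ∉ slabConn k Q.R Q.A Q.C := fun h => hX.2 (slabConn_comm h)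
  obtain ⟨dg, hdg⟩ := exists_directGlue (R := Q.R) (Src := Q.A) (Tg := Q.C) (xL := max 0 (z.1 - 13))
    (xR := min (14 * (n : ℤ)) (z.1 + 13)) (rB := max 0 (z.2 - 13)) (rT := min (13 * (n : ℤ) - 1) (z.2 + 13))
    hDR hDA hhdA (hmD _ (List.getLast_mem hm)) hconn hadj hw'D hw'C hc'D hc'C
  refine ⟨dg.newConfig, GadgetSpec.of_directGlue_C hX dg ⟨z, fun w hw => ?_⟩⟩
  rw [hdg] at hw
  exact sqBox_mono _ (by norm_num) ((memD w).1 hw).2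

end NTW17

end Literature.Probability.Percolation
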